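import Literature.IUT.HodgeArakelov.MonoThetaProjectiveThetaEnvRecord
import Literature.IUT.HodgeArakelov.EtaleThetaDataOfSettingInversion

/-!
# Bridge B8, part 5f: J2 for the GENUINE `θ_env` data with `ι` ranging over the `Π_X(𝕄_*)`-CONJUGATES of an inversion
# action — the residual `hι` of part 5e DISCHARGED («conjugates of inversion automorphisms are inversion automorphisms»)

abc-iut cell, MERGE-MAP §8 **B8** (layer L6 ↔ L2), seat abc-iut-w4-d030 (gen 2); sub-DAG
`plan/L6/SUBDAG-IUTchII-Prop-31-33-34.md` (W6-S6, holder abc-iut-w5-d169), row J2 at the natural system of `X̲̲_K`.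
S. Mochizuki, *Inter-universal Teichmüller theory II*, kurims manuscript (Dec. 2020), Prop. 3.1 (i) p. 87 l. 47–53
("`ι` ranges over the inversion automorphisms of Proposition 2.2, (i) … equipped with a natural conjugation action by
`Π_X(M^Θ_*)`"), Prop. 2.2 (i) p. 66 / Cor. 1.12 (i) pp. 56–57 ("`ι` is a `Δ_Ÿ(Π)`-outer automorphism of `Π_Ÿ(Π)`": the
pointed inversion automorphisms are given up to `Π`-conjugation) [claim: Mochizuki2012, status: disputed]
(IUTchII §3 Prop 3.1 (i), kurims p.87).

Part 5e (`MonoThetaProjectiveThetaEnvRecord`, p418653) proved abc-iut-w5-d169's J2 predicate `ThetaEnvPermuted` for the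
Prop. 3.1 record PRODUCED (abc-iut-w4-d019's `ThetaEnvData.toRecord`, p417552) from the genuine `θ_env` data
`EtaleLevels.thetaEnvData` with the REAL conjugation action, for every Kummer map `κ` and every inversion family
`iota : Iota → (lim ≃+ lim)` satisfying `hι : ∀ g ι, ∃ ι', iota ι' ∘ conj_g = conj_g ∘ iota ι` — `hι` BY NAME.
HERE `hι` is DISCHARGED for the family print describes: fix ONE inversion action `ρ` on
`lim_J H¹(Π_Ÿ(𝕄_*)|_J, (l·Δ_Θ)(𝕄_*))` (at the model: abc-iut-w5-d072's `EtaleThetaDataOfSetting.pairRhoLim` = abc-iut-L6-t1's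
`h1LimAutEquiv` of the pointed-inversion PAIR `(α, β)` of `(Π^tp_{X̲̲}, (Π^tp_X)^Θ)`, p417251/p412842; for `α := ι|_{Π^tp_{X̲̲}}`,
`β :=` its theta companion see d072's `inversionAlpha` / `prop22_ii'_model_of_inversion`) and let `ι` range over its
`Π_X(𝕄_*)`-CONJUGATES `h ↦ conj_h ∘ ρ ∘ conj_h⁻¹` (`h ∈ Π^tp_{X̲̲}`; the transports of the conjugate automorphisms
`Inn(h) ∘ ι ∘ Inn(h)⁻¹`, i.e. the `Π`-conjugacy class of the `Δ_Ÿ(Π)`-outer automorphism `ι`). For THIS family the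
compatibility `hι` is the ACTION LAW of the conjugation action alone (abc-iut-w4-d043's `h1LimConj_mul_apply`):
`conj_{gh} ∘ ρ ∘ conj_{gh}⁻¹ ∘ conj_g = conj_g ∘ (conj_h ∘ ρ ∘ conj_h⁻¹)` — no hypothesis on `ρ`. Hence:
* `CohomologySystemOfContH1.conjugate_family_compat` — the generic identity over any instantiated cohomology system;
* `EtaleLevels.thetaEnvPermuted_record_conjugates` — J2 for the genuine record with `ι` ranging over the conjugates of ANY
  `ρ`, UNCONDITIONALLY (every hypothesis of abc-iut-w4-d019's `thetaEnvPermuted_toRecord` discharged);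
* `EtaleLevels.thetaEnvPermuted_record_inversionPair` — the same with `ρ :=` d072's `pairRhoLim C α β hφ hA hH` of an
  automorphism pair (the genuine pointed inversion of [IUTchII] Rmk. 1.4.1 (ii) at the model);
* `EtaleLevels.conj_permutes_both_record_conjugates` — abc-iut-L6-d3/w5-d169's «the conjugation action permutes BOTH
  families `{Ψ^ι_env}`, `{∞Ψ^ι_env}`» for this record, modulo `hU` (`M^×_TM` stable) only.
Complementary to abc-iut-w4-d019's `ThetaEnvDataRecordModel` (p419125: the ELEMENT-induced family); this is the
automorphism-PAIR (outer) family. PROOF-ONLY (no definitions: the family is written as an explicit lambda). HONEST FRAMING: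
kernel facts about the cell's own model objects; nothing disputed is asserted; no side taken on [IUTchIII] Cor. 3.12;
typed ≠ discharged.
-/

noncomputable section

namespace Literature.IUT.HodgeArakelov

open Literature.AnabelianGeometry.EtaleTheta Literature.AnabelianGeometry.SemiGraphs
open CohomologySystemOfContH1 EtaleThetaDataOfSetting
open scoped Literature.AnabelianGeometry.EtaleTheta

universe u

/-! ### Generic: the `Π`-conjugates of a limit automorphism form a conjugation-compatible family -/

namespace CohomologySystemOfContH1

variable {P : TopGroup.{u}} {G' : Type u} [Group G'] [TopologicalSpace G'] [IsTopologicalGroup G']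
  (φ : P →* G') (A : Subgroup G') [A.Normal] [IsMulCommutative A] (H : Subgroup P) [H.Normal]

/-- **«Conjugates of inversion automorphisms are inversion automorphisms»** at the level of the conjugation action on
`lim_K H¹(H ⊓ K, A)`: for ANY additive automorphism `ρ` of the limit and `g, h ∈ Π`,
`(conj_{gh} ∘ ρ ∘ conj_{gh}⁻¹) ∘ conj_g = conj_g ∘ (conj_h ∘ ρ ∘ conj_h⁻¹)` — the action law of abc-iut-w4-d043's
`h1LimConjEquiv`. [claim: Mochizuki2012, status: disputed] (IUTchII §2 Prop 2.2 (i), kurims p.66) -/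
theorem conjugate_family_compat (ρ : h1Lim φ A H ⊥ ≃+ h1Lim φ A H ⊥) (g h : P) (x : h1Lim φ A H ⊥) :
    ((h1LimConjEquiv φ A H (g * h)⁻¹).trans (ρ.trans (h1LimConjEquiv φ A H (g * h))))
        (h1LimConjEquiv φ A H g x) =
      h1LimConjEquiv φ A H g
        (((h1LimConjEquiv φ A H h⁻¹).trans (ρ.trans (h1LimConjEquiv φ A H h))) x) := by
  simp only [AddEquiv.trans_apply, h1LimConjEquiv_apply]
  rw [mul_inv_rev, ← h1LimConj_mul_apply φ A H (h⁻¹ * g⁻¹) g x, inv_mul_cancel_right, h1LimConj_mul_apply]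

end CohomologySystemOfContH1

/-! ### J2 for the genuine record, `ι` ranging over the conjugates of an inversion action -/

namespace EtaleLevels

variable {p : ℕ} [Fact p.Prime] {D : Literature.AnabelianGeometry.EtaleTheta.ThetaSetting p}
  {E : D.EtaleThetaData} {l : ℕ} (C : E.DoubleUnderline l) (hC : D.Compat) (hS : D.Sec2Hyps)
  (hl : l.Prime) (hp2 : p ≠ 2) (hpl : p ≠ l) (hζ : ∃ ζ : D.K, IsPrimitiveRoot ζ (4 * l))
  (mods : ∀ M : ℕ+, D.CyclotomeMod l M)
  (f : contCocycles D.toTheta D.DeltaTheta C.GtpYdduu) (hf : f ∈ C.rootCocycles hC)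
  (hmods : ∀ (M M' : ℕ+) (h : (M : ℕ) ∣ (M' : ℕ)) (x : D.lDeltaTheta l),
    MuN.red p M M' h ((mods M').red x) = (mods M).red x)
  (h15 : Literature.AnabelianGeometry.EtaleTheta.ThetaSetting.Prop15iii E hC) (L : C.CuspLabels)
  (hZ : ∀ M : ℕ+, Nonempty (ModelCyclotomes.lDeltaQuot (C.rigidData (mods M) hC hS h15 L) ≃*
    Literature.IUT.HodgeTheaters.ZHat))
  (hcharY : EtaleThetaDataOfSetting.PiYddCharacteristic C)
  (hlim : Function.Bijective (rigidLimHom C hC hS hl hp2 hpl hζ mods f hf hmods h15 L hZ))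
  [(EtaleThetaDataOfSetting.PiYdd C).Normal]

/-- **J2 — [IUTchII] Prop. 3.1 (i) for the genuine `θ_env` data, `ι` ranging over the `Π_X(𝕄_*)`-conjugates of ANY
inversion action `ρ` on the limit** (`ι_h := conj_h ∘ ρ ∘ conj_h⁻¹`, `h ∈ Π^tp_{X̲̲}`): the conjugation action PERMUTES
`{θ^ι_env(𝕄_*)}_ι` and `{∞θ^ι_env(𝕄_*)}_ι` — UNCONDITIONALLY (the residual `hι` of part 5e is the action law,
`conjugate_family_compat`). [claim: Mochizuki2012, status: disputed] (IUTchII §3 Prop 3.1 (i), kurims p.87) -/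
theorem thetaEnvPermuted_record_conjugates {M : Type} [CommMonoid M]
    (κ : M →* Multiplicative (thetaEnvData C hC hS hl hp2 hpl hζ mods f hf hmods h15 L hZ hcharY hlim).cohEnv.lim)
    (ρ : (coh C).lim ≃+ (coh C).lim) :
    ((thetaEnvData C hC hS hl hp2 hpl hζ mods f hf hmods h15 L hZ hcharY hlim).toRecord
      (h1LimConjMulAut (phi C) (D.lDeltaTheta l) (PiYdd C)) κ
      (fun h : Pi C => (h1LimConjEquiv (phi C) (D.lDeltaTheta l) (PiYdd C) h⁻¹).trans
        (ρ.trans (h1LimConjEquiv (phi C) (D.lDeltaTheta l) (PiYdd C) h)))).ThetaEnvPermuted :=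
  thetaEnvPermuted_record C hC hS hl hp2 hpl hζ mods f hf hmods h15 L hZ hcharY hlim κ _
    (fun g h => ⟨g * h, fun x =>
      CohomologySystemOfContH1.conjugate_family_compat (phi C) (D.lDeltaTheta l) (PiYdd C) ρ g h x⟩)

/-- **J2 at the GENUINE pointed inversion**: the same with `ρ :=` abc-iut-w5-d072's `pairRhoLim C α β hφ hA hH` — the
action on the limit of an automorphism PAIR `(α, β)` of `(Π^tp_{X̲̲}, (Π^tp_X)^Θ)` compatible with `φ`, stabilising `l·Δ_Θ` and
`Π^tp_{Ÿ̲̲}` (abc-iut-L6-t1's `h1LimAutEquiv`; for the pointed inversion of [IUTchII] Rmk. 1.4.1 (ii): `α := inversionAlpha C ι hι`,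
`β :=` the theta companion of `ι`, d072's `EtaleThetaDataOfSettingInversion` §2). [claim: Mochizuki2012, status: disputed]
(IUTchII §3 Prop 3.1 (i), kurims p.87) -/
theorem thetaEnvPermuted_record_inversionPair {M : Type} [CommMonoid M]
    (κ : M →* Multiplicative (thetaEnvData C hC hS hl hp2 hpl hζ mods f hf hmods h15 L hZ hcharY hlim).cohEnv.lim)
    (α : (Pi C) ≃ₜ* (Pi C)) (β : D.GtpTheta ≃ₜ* D.GtpTheta) (hφ : ∀ g, β (phi C g) = phi C (α g))
    (hA : ∀ a : D.GtpTheta, a ∈ D.lDeltaTheta l ↔ β a ∈ D.lDeltaTheta l)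
    (hH : ∀ x, x ∈ PiYdd C ↔ α x ∈ PiYdd C) :
    ((thetaEnvData C hC hS hl hp2 hpl hζ mods f hf hmods h15 L hZ hcharY hlim).toRecord
      (h1LimConjMulAut (phi C) (D.lDeltaTheta l) (PiYdd C)) κ
      (fun h : Pi C => (h1LimConjEquiv (phi C) (D.lDeltaTheta l) (PiYdd C) h⁻¹).trans
        ((pairRhoLim C α β hφ hA hH).trans (h1LimConjEquiv (phi C) (D.lDeltaTheta l) (PiYdd C) h)))).ThetaEnvPermuted :=
  thetaEnvPermuted_record_conjugates C hC hS hl hp2 hpl hζ mods f hf hmods h15 L hZ hcharY hlim κ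
    (pairRhoLim C α β hφ hA hH)

/-- **Corollary**: for the record with `ι` ranging over the conjugates of an inversion action `ρ`, once `M^×_TM` is stable
(`hU`), the conjugation action permutes BOTH families of theta monoids `{Ψ^ι_env(𝕄_*)}_ι`, `{∞Ψ^ι_env(𝕄_*)}_ι` with the
re-indexing `ι_h ↦ ι_{gh}` (abc-iut-L6-d3/w5-d169's `conj_permutes_both_of_thetaEnvPermuted`).
[claim: Mochizuki2012, status: disputed] (IUTchII §3 Prop 3.1 (i), kurims p.87) -/
theorem conj_permutes_both_record_conjugates {M : Type} [CommMonoid M]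
    (κ : M →* Multiplicative (thetaEnvData C hC hS hl hp2 hpl hζ mods f hf hmods h15 L hZ hcharY hlim).cohEnv.lim)
    (ρ : (coh C).lim ≃+ (coh C).lim)
    (hU : ∀ (g : Pi C) (x : ((thetaEnvData C hC hS hl hp2 hpl hζ mods f hf hmods h15 L hZ hcharY hlim).toRecord
        (h1LimConjMulAut (phi C) (D.lDeltaTheta l) (PiYdd C)) κ
        (fun h : Pi C => (h1LimConjEquiv (phi C) (D.lDeltaTheta l) (PiYdd C) h⁻¹).trans
          (ρ.trans (h1LimConjEquiv (phi C) (D.lDeltaTheta l) (PiYdd C) h)))).H),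
      x ∈ ((thetaEnvData C hC hS hl hp2 hpl hζ mods f hf hmods h15 L hZ hcharY hlim).toRecord
          (h1LimConjMulAut (phi C) (D.lDeltaTheta l) (PiYdd C)) κ
          (fun h : Pi C => (h1LimConjEquiv (phi C) (D.lDeltaTheta l) (PiYdd C) h⁻¹).trans
            (ρ.trans (h1LimConjEquiv (phi C) (D.lDeltaTheta l) (PiYdd C) h)))).units →
        ((thetaEnvData C hC hS hl hp2 hpl hζ mods f hf hmods h15 L hZ hcharY hlim).toRecord
          (h1LimConjMulAut (phi C) (D.lDeltaTheta l) (PiYdd C)) κ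
          (fun h : Pi C => (h1LimConjEquiv (phi C) (D.lDeltaTheta l) (PiYdd C) h⁻¹).trans
            (ρ.trans (h1LimConjEquiv (phi C) (D.lDeltaTheta l) (PiYdd C) h)))).conj g x ∈
          ((thetaEnvData C hC hS hl hp2 hpl hζ mods f hf hmods h15 L hZ hcharY hlim).toRecord
            (h1LimConjMulAut (phi C) (D.lDeltaTheta l) (PiYdd C)) κ
            (fun h : Pi C => (h1LimConjEquiv (phi C) (D.lDeltaTheta l) (PiYdd C) h⁻¹).trans
              (ρ.trans (h1LimConjEquiv (phi C) (D.lDeltaTheta l) (PiYdd C) h)))).units)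
    (g : Pi C) (h : Pi C) :
    ∃ h' : Pi C,
      (((thetaEnvData C hC hS hl hp2 hpl hζ mods f hf hmods h15 L hZ hcharY hlim).toRecord
          (h1LimConjMulAut (phi C) (D.lDeltaTheta l) (PiYdd C)) κ
          (fun h : Pi C => (h1LimConjEquiv (phi C) (D.lDeltaTheta l) (PiYdd C) h⁻¹).trans
            (ρ.trans (h1LimConjEquiv (phi C) (D.lDeltaTheta l) (PiYdd C) h)))).thetaMonoid h).map
          (((thetaEnvData C hC hS hl hp2 hpl hζ mods f hf hmods h15 L hZ hcharY hlim).toRecord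
            (h1LimConjMulAut (phi C) (D.lDeltaTheta l) (PiYdd C)) κ
            (fun h : Pi C => (h1LimConjEquiv (phi C) (D.lDeltaTheta l) (PiYdd C) h⁻¹).trans
              (ρ.trans (h1LimConjEquiv (phi C) (D.lDeltaTheta l) (PiYdd C) h)))).conj g).toMonoidHom =
        ((thetaEnvData C hC hS hl hp2 hpl hζ mods f hf hmods h15 L hZ hcharY hlim).toRecord
          (h1LimConjMulAut (phi C) (D.lDeltaTheta l) (PiYdd C)) κ
          (fun h : Pi C => (h1LimConjEquiv (phi C) (D.lDeltaTheta l) (PiYdd C) h⁻¹).trans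
            (ρ.trans (h1LimConjEquiv (phi C) (D.lDeltaTheta l) (PiYdd C) h)))).thetaMonoid h' ∧
      (((thetaEnvData C hC hS hl hp2 hpl hζ mods f hf hmods h15 L hZ hcharY hlim).toRecord
          (h1LimConjMulAut (phi C) (D.lDeltaTheta l) (PiYdd C)) κ
          (fun h : Pi C => (h1LimConjEquiv (phi C) (D.lDeltaTheta l) (PiYdd C) h⁻¹).trans
            (ρ.trans (h1LimConjEquiv (phi C) (D.lDeltaTheta l) (PiYdd C) h)))).inftyThetaMonoid h).map
          (((thetaEnvData C hC hS hl hp2 hpl hζ mods f hf hmods h15 L hZ hcharY hlim).toRecord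
            (h1LimConjMulAut (phi C) (D.lDeltaTheta l) (PiYdd C)) κ
            (fun h : Pi C => (h1LimConjEquiv (phi C) (D.lDeltaTheta l) (PiYdd C) h⁻¹).trans
              (ρ.trans (h1LimConjEquiv (phi C) (D.lDeltaTheta l) (PiYdd C) h)))).conj g).toMonoidHom =
        ((thetaEnvData C hC hS hl hp2 hpl hζ mods f hf hmods h15 L hZ hcharY hlim).toRecord
          (h1LimConjMulAut (phi C) (D.lDeltaTheta l) (PiYdd C)) κ
          (fun h : Pi C => (h1LimConjEquiv (phi C) (D.lDeltaTheta l) (PiYdd C) h⁻¹).trans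
            (ρ.trans (h1LimConjEquiv (phi C) (D.lDeltaTheta l) (PiYdd C) h)))).inftyThetaMonoid h' :=
  TemperedThetaMonoids.ThetaEnvData.conj_permutes_both_of_thetaEnvPermuted _
    (thetaEnvPermuted_record_conjugates C hC hS hl hp2 hpl hζ mods f hf hmods h15 L hZ hcharY hlim κ ρ) hU g h

end EtaleLevels

end Literature.IUT.HodgeArakelov
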